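import Literature.NumberTheory.GaloisRepresentations.ContinuousCohomologyIntIndex
import Literature.NumberTheory.GaloisRepresentations.ContinuousCharactersExtend
import HarnessLib

/-!
# Pull-back on `H²(·, ℤ)`: kernel killed by the index of the image; injectivity for dense image

Topic `NumberTheory/GaloisRepresentations`; namespace `Literature.NumberTheory.GaloisRepresentations`.
Theorems only (no definition, no named fact).  For a continuous homomorphism `θ : G' → G` of
profinite groups and `c ∈ H²(G, ℤ)` with character `χ_c = H2IntEquivHom G c`:

* `pullH_two_ZCoeff_eq_zero_iff_forall_mem_range` — `θ^* c = 0 ↔ χ_c` kills `θ(G')`;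
* **`index_range_nsmul_eq_zero_of_pullH_eq_zero` — if `θ(G')` has finite index `m` then
  `θ^* c = 0 ⇒ m • c = 0`** (for `θ = res : Γ_E ↪ Γ_F` this is "the kernel of
  `H²(Γ_F, ℤ) → H²(Γ_E, ℤ)` is killed by `[E : F]`", the `ℤ`-shadow of `cor ∘ res = [E:F]`,
  Serre, *Galois Cohomology* I §2.4 Prop. 9);
* `character_eq_zero_of_forall_mem_dense` — a continuous character vanishing on a dense subgroup is
  zero; **`pullH_two_ZCoeff_injective_of_denseRange` — `θ^*` is injective on `H²(·, ℤ)` when `θ`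
  has dense image**, and `pullH_two_ZCoeff_injective_of_dense_range_sup_commutator` — more generally
  when `θ(G') · [G, G]` is dense (characters only see `G^ab`).

Honest framing: classical; nothing here bears on abc or takes a side on [IUTchIII] Cor. 3.12.

## References
* J.-P. Serre, *Galois Cohomology* (1997), I §2.4 Prop. 9. [SerreGaloisCohomology1997]
-/

noncomputable section

open CategoryTheory Function

universe u

namespace Literature.NumberTheory.GaloisRepresentations

open _root_.TopRep _root_.ContRepresentation _root_.ContinuousCohomology _root_.Topology

section Character

variable {G : Type u} [Group G] [TopologicalSpace G] [IsTopologicalGroup G]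
variable {A : Type u} [AddCommGroup A] [TopologicalSpace A] [DiscreteTopology A]

/-- **A continuous character vanishing on a dense subgroup is zero** (its kernel is an open, hence
closed, subgroup containing a dense set). [cite: SerreGaloisCohomology1997, I §2.4] -/
theorem character_eq_zero_of_forall_mem_dense
    (χ : contOneCocycles (ContinuousRep.trivial G ℤ A).toTopRep) (S : Subgroup G)
    (hS : Dense (S : Set G)) (hχ : ∀ s ∈ S, χ.1 s = 0) : χ = 0 := by
  have hker : oneCocycleKer χ = ⊤ := by
    rw [eq_top_iff]
    intro g _
    have hclosed : IsClosed (oneCocycleKer χ : Set G) :=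
      OpenSubgroup.isClosed ⟨oneCocycleKer χ, isOpen_oneCocycleKer χ⟩
    have hle : (S : Set G) ⊆ oneCocycleKer χ := fun s hs => (mem_oneCocycleKer_iff χ s).mpr (hχ s hs)
    have : g ∈ closure (S : Set G) := by rw [hS.closure_eq]; exact Set.mem_univ g
    exact closure_minimal hle hclosed this
  refine Subtype.ext (ContinuousMap.ext fun g => ?_)
  exact (mem_oneCocycleKer_iff χ g).mp (hker ▸ Subgroup.mem_top g)

/-- A continuous character vanishing on a subgroup `S` with `S ⊔ [G, G]` dense is zero (characters
kill commutators). [cite: SerreGaloisCohomology1997, I §2.4] -/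
theorem character_eq_zero_of_forall_mem_of_dense_sup_commutator
    (χ : contOneCocycles (ContinuousRep.trivial G ℤ A).toTopRep) (S : Subgroup G)
    (hS : Dense ((S ⊔ commutator G : Subgroup G) : Set G)) (hχ : ∀ s ∈ S, χ.1 s = 0) : χ = 0 := by
  refine character_eq_zero_of_forall_mem_dense χ (S ⊔ commutator G) hS fun g hg => ?_
  have hle : S ⊔ commutator G ≤ oneCocycleKer χ :=
    sup_le (fun s hs => (mem_oneCocycleKer_iff χ s).mpr (hχ s hs))
      ((Subgroup.le_topologicalClosure _).trans (commutatorClosure_le_oneCocycleKer χ))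
  exact (mem_oneCocycleKer_iff χ g).mp (hle hg)

end Character

section Pullback

variable {G : Type u} [Group G] [TopologicalSpace G] [IsTopologicalGroup G] [CompactSpace G]
  [T2Space G] [TotallyDisconnectedSpace G]
variable {G' : Type u} [Group G'] [TopologicalSpace G'] [IsTopologicalGroup G'] [CompactSpace G']
  [T2Space G'] [TotallyDisconnectedSpace G']

/-- `θ^* c = 0 ↔ χ_c` vanishes on the image subgroup `θ(G')`. [cite: SerreGaloisCohomology1997, I §2.4] -/
theorem pullH_two_ZCoeff_eq_zero_iff_forall_mem_range (θ : G' →ₜ* G)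
    (c : continuousCohomology 2 (ContinuousRep.trivial G ℤ ZCoeff.{u}).toTopRep) :
    pullH θ (ContinuousRep.trivial G ℤ ZCoeff.{u}) 2 c = 0 ↔
      ∀ g ∈ θ.toMonoidHom.range, (H2IntEquivHom G c).1 g = 0 := by
  rw [pullH_two_ZCoeff_eq_zero_iff]
  constructor
  · rintro h g ⟨g', rfl⟩; exact h g'
  · exact fun h g' => h _ ⟨g', rfl⟩

/-- **The kernel of `θ^* : H²(G, ℤ) → H²(G', ℤ)` is killed by the index of `θ(G')`** (finite index,
e.g. `θ` with open image): `θ^* c = 0 ⇒ (G : θ(G')) • c = 0` — for the restriction `Γ_E ↪ Γ_F` of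
a finite extension, the kernel of `H²(Γ_F, ℤ) → H²(Γ_E, ℤ)` is killed by the index.
[cite: SerreGaloisCohomology1997, I §2.4 Prop. 9] -/
theorem index_range_nsmul_eq_zero_of_pullH_eq_zero (θ : G' →ₜ* G) [θ.toMonoidHom.range.FiniteIndex]
    (c : continuousCohomology 2 (ContinuousRep.trivial G ℤ ZCoeff.{u}).toTopRep)
    (hc : pullH θ (ContinuousRep.trivial G ℤ ZCoeff.{u}) 2 c = 0) :
    θ.toMonoidHom.range.index • c = 0 := by
  apply (H2IntEquivHom G).injective
  rw [map_nsmul, map_zero]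
  exact index_nsmul_eq_zero_of_forall_mem _ _
    ((pullH_two_ZCoeff_eq_zero_iff_forall_mem_range θ c).mp hc)

/-- **`θ^*` is injective on `H²(·, ℤ)` when `θ` has dense image** (e.g. `θ` surjective, or the
inclusion of a dense subgroup). [cite: SerreGaloisCohomology1997, I §2.4] -/
theorem pullH_two_ZCoeff_injective_of_denseRange (θ : G' →ₜ* G) (hθ : DenseRange θ) :
    Injective (pullH θ (ContinuousRep.trivial G ℤ ZCoeff.{u}) 2) := by
  intro c₁ c₂ h
  rw [← sub_eq_zero] at h ⊢
  have h' : pullH θ (ContinuousRep.trivial G ℤ ZCoeff.{u}) 2 (c₁ - c₂) = 0 := by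
    rw [map_sub]; exact h
  apply (H2IntEquivHom G).injective
  rw [map_zero]
  refine character_eq_zero_of_forall_mem_dense _ θ.toMonoidHom.range ?_
    ((pullH_two_ZCoeff_eq_zero_iff_forall_mem_range θ _).mp h')
  rw [MonoidHom.coe_range]
  exact hθ

/-- **`θ^*` is injective on `H²(·, ℤ)` as soon as `θ(G') · [G, G]` is dense in `G`** (characters
factor through `G^ab`). [cite: SerreGaloisCohomology1997, I §2.4] -/
theorem pullH_two_ZCoeff_injective_of_dense_range_sup_commutator (θ : G' →ₜ* G)
    (hθ : Dense ((θ.toMonoidHom.range ⊔ commutator G : Subgroup G) : Set G)) :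
    Injective (pullH θ (ContinuousRep.trivial G ℤ ZCoeff.{u}) 2) := by
  intro c₁ c₂ h
  rw [← sub_eq_zero] at h ⊢
  have h' : pullH θ (ContinuousRep.trivial G ℤ ZCoeff.{u}) 2 (c₁ - c₂) = 0 := by
    rw [map_sub]; exact h
  apply (H2IntEquivHom G).injective
  rw [map_zero]
  exact character_eq_zero_of_forall_mem_of_dense_sup_commutator _ θ.toMonoidHom.range hθ
    ((pullH_two_ZCoeff_eq_zero_iff_forall_mem_range θ _).mp h')

end Pullback

/-! ### Restriction `H²(G, ℤ) → H²(N, ℤ)` is onto for profinite ABELIAN `G` -/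

section AbelianRes

variable {G : Type u} [CommGroup G] [TopologicalSpace G] [IsTopologicalGroup G] [CompactSpace G]
  [T2Space G] [TotallyDisconnectedSpace G]

/-- **`res : H²(G, ℤ) → H²(N, ℤ)` is surjective for every compact (closed) subgroup `N` of a
profinite ABELIAN group `G`**: through `H²(·, ℤ) ≅ Hom_cont(·, ℚ/ℤ)` (`H2IntEquivHom`, natural by
`H2IntEquivHom_pullH`) this is the extension of characters from `N` to `G`
(`exists_character_extend_of_profinite`, Pontryagin: profinite abelian groups are dually embedded).
[cite: SerreLocalFields1979, XIII §1] -/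
theorem pullH_subgroupIncl_two_ZCoeff_surjective_of_comm (N : Subgroup G) [CompactSpace N] :
    Surjective (pullH (subgroupIncl N) (ContinuousRep.trivial G ℤ ZCoeff.{u}) 2) := by
  intro cN
  obtain ⟨χ, hχ⟩ := exists_character_extend_of_profinite N (H2IntEquivHom N cN)
  refine ⟨(H2IntEquivHom G).symm χ, ?_⟩
  apply (H2IntEquivHom N).injective
  rw [H2IntEquivHom_pullH, LinearEquiv.apply_symm_apply]
  exact Subtype.ext (ContinuousMap.ext fun n => hχ n)

/-- In particular every class of `H²(N, ℤ)` is the restriction of a class of `H²(G, ℤ)`.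
[cite: SerreLocalFields1979, XIII §1] -/
theorem exists_pullH_subgroupIncl_two_ZCoeff_eq_of_comm (N : Subgroup G) [CompactSpace N]
    (cN : continuousCohomology 2 (ContinuousRep.trivial N ℤ ZCoeff.{u}).toTopRep) :
    ∃ c : continuousCohomology 2 (ContinuousRep.trivial G ℤ ZCoeff.{u}).toTopRep,
      pullH (subgroupIncl N) (ContinuousRep.trivial G ℤ ZCoeff.{u}) 2 c = cN :=
  pullH_subgroupIncl_two_ZCoeff_surjective_of_comm N cN

end AbelianRes

/-! ### `0 → H²(G/N, ℤ) → H²(G, ℤ) → H²(N, ℤ) → 0` for profinite abelian `G` -/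

section AbelianSES

variable {G : Type u} [CommGroup G] [TopologicalSpace G] [IsTopologicalGroup G] [CompactSpace G]
  [T2Space G] [TotallyDisconnectedSpace G]
variable (N : Subgroup G) [CompactSpace N] [CompactSpace (G ⧸ N)] [T2Space (G ⧸ N)]
  [TotallyDisconnectedSpace (G ⧸ N)]

/-- **The short exact sequence `0 → H²(G/N, ℤ) → H²(G, ℤ) → H²(N, ℤ) → 0`** for a closed subgroup
`N` of a profinite ABELIAN group `G` (with `G/N` profinite): inflation injective, exact in the middle
(`exact_inf_res_two_ZCoeff`, any profinite `G`), restriction surjective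
(`pullH_subgroupIncl_two_ZCoeff_surjective_of_comm`, abelian `G`) — the `H²(·, ℤ)`-form of the dual
sequence `0 → (G/N)^∨ → G^∨ → N^∨ → 0`. [cite: SerreGaloisCohomology1997, I §2.6 (b)] -/
theorem inf_res_two_ZCoeff_shortExact_of_comm :
    Injective (pullH (ContinuousMonoidHom.quotientMk N)
        (ContinuousRep.trivial (G ⧸ N) ℤ ZCoeff.{u}) 2) ∧
      Function.Exact
        (pullH (ContinuousMonoidHom.quotientMk N) (ContinuousRep.trivial (G ⧸ N) ℤ ZCoeff.{u}) 2)
        (pullH (subgroupIncl N) (ContinuousRep.trivial G ℤ ZCoeff.{u}) 2) ∧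
      Surjective (pullH (subgroupIncl N) (ContinuousRep.trivial G ℤ ZCoeff.{u}) 2) :=
  ⟨inf_two_ZCoeff_injective N, exact_inf_res_two_ZCoeff N,
    pullH_subgroupIncl_two_ZCoeff_surjective_of_comm N⟩

end AbelianSES

end Literature.NumberTheory.GaloisRepresentations

end
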